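import Literature.Computability.Cryptography.CubicClassSamplingDecode
import HarnessLib

/-!
# The class-group stage: accurate outcomes of a unit as slices of the character range

Topic `Computability/Cryptography`; theorem-only file, no named facts. Sequel of `CubicClassSamplingDecode.lean`
(`mem_Acc_slice_iff`). For the post-processor parameters `⟨T, ℓe, s, aexp, top, K₀, B⟩` (`S = 2^s`, `W = 2^(ℓe T)`,
`a = 2^(top+aexp)`, characters `c < a·S·W`) and the coupling `μ'_t = μ_t + 2^-s M^-(T−t)`:

* `signedResidue_unique` — a signed residue `kk` (`|kk| ≤ K₀ < S/2`) comes from exactly one residue `k₀ < S`;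
* `filter_range_Acc_eq_image` — the characters `c < aSW` accurate for `(kk, ξ')` with `Φ ξ'` are EXACTLY the
  `a(k₀ + Sν)`, `ν < W`, whose slice angles `k₀/(S M^{T−t}) + kk μ_t + ξ'_t + ν/M^{T−t}` are all within `δ` of `ℤ`
  (`k₀` the residue of `kk`);
* `filter_range_Acc_eq_empty` — if `kk` is the signed residue of no `k₀ < S`, no character is accurate for `kk`;
* `not_mem_AccAll_slice_imp` — a character `a(k₀ + Sν)` accurate for NO dual vector has its residue in the tail
  `K₀ < k₀ < S − K₀`, or else its frequency `ν` accurate for no dual vector in the slice of `k₀`.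
[Hallgren 2005, §4]

## References

* S. Hallgren, STOC 2005, §4. [Hallgren2005]
* A. Yu. Kitaev, arXiv:quant-ph/9511026 (1995), §4. [Kitaev1995]
-/

noncomputable section

open scoped Classical

namespace Literature.Computability.Cryptography

namespace CubicClassSampling

open CubicClassPost Finset

/-- **A signed residue comes from one residue.** [folklore] -/
theorem signedResidue_unique : ∀ {s K₀ k₀ k₀' : ℕ} {kk : ℤ}, k₀ < 2 ^ s → k₀' < 2 ^ s → 2 * K₀ < 2 ^ s →
    ((k₀ ≤ K₀ ∧ kk = k₀) ∨ (2 ^ s - K₀ ≤ k₀ ∧ kk = (k₀ : ℤ) - (2 ^ s : ℕ))) →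
    ((k₀' ≤ K₀ ∧ kk = k₀') ∨ (2 ^ s - K₀ ≤ k₀' ∧ kk = (k₀' : ℤ) - (2 ^ s : ℕ))) → k₀' = k₀ := by
  intro s K₀ k₀ k₀' kk hk₀ hk₀' hK h h'
  generalize hS : 2 ^ s = S at *
  have hsub : S - K₀ + K₀ = S := Nat.sub_add_cancel (by omega)
  rcases h with ⟨_, h1⟩ | ⟨_, h1⟩ <;> rcases h' with ⟨_, h2⟩ | ⟨_, h2⟩ <;> omega

section Slices

variable (T ℓe s aexp top K₀ B : ℕ) (μ : Fin T → ℝ) (δ : ℝ)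

/-- **The accurate characters of a unit are one slice of the character range.** For `kk` the signed residue of `k₀ < S`
(`2K₀ < S`) and any side condition `Φ` on the dual vector: the `c < a·S·W` with `c ∈ Acc ⟨…⟩ μ' δ kk ξ'` for some `ξ'`
with `Φ ξ'` are exactly the `a(k₀ + Sν)`, `ν < W`, all of whose slice angles for some such `ξ'` are within `δ` of `ℤ`.
[cite: Hallgren2005, §4] -/
theorem filter_range_Acc_eq_image (Φ : (Fin T → ℚ) → Prop) {k₀ : ℕ} (hk₀ : k₀ < 2 ^ s) (hK : 2 * K₀ < 2 ^ s) (kk : ℤ)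
    (hval : (k₀ ≤ K₀ ∧ kk = k₀) ∨ (2 ^ s - K₀ ≤ k₀ ∧ kk = (k₀ : ℤ) - (2 ^ s : ℕ))) :
    (range (2 ^ (top + aexp) * (2 ^ s * 2 ^ (ℓe * T)))).filter (fun c => ∃ ξ' : Fin T → ℚ, Φ ξ' ∧
        c ∈ Acc ⟨T, ℓe, s, aexp, top, K₀, B⟩
          (fun t => μ t + 1 / (((2 ^ s : ℕ) : ℝ) * ((2 ^ ℓe : ℕ) : ℝ) ^ (T - (t : ℕ)))) δ kk ξ') =
      ((range (2 ^ (ℓe * T))).filter (fun ν : ℕ => ∃ ξ' : Fin T → ℚ, Φ ξ' ∧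
        ∀ t : Fin T, |(k₀ : ℝ) / (((2 ^ s : ℕ) : ℝ) * ((2 ^ ℓe : ℕ) : ℝ) ^ (T - (t : ℕ))) + (kk : ℝ) * μ t + (ξ' t : ℝ) +
            (ν : ℝ) / ((2 ^ ℓe : ℕ) : ℝ) ^ (T - (t : ℕ)) -
          round ((k₀ : ℝ) / (((2 ^ s : ℕ) : ℝ) * ((2 ^ ℓe : ℕ) : ℝ) ^ (T - (t : ℕ))) + (kk : ℝ) * μ t + (ξ' t : ℝ) +
            (ν : ℝ) / ((2 ^ ℓe : ℕ) : ℝ) ^ (T - (t : ℕ)))| ≤ δ)).image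
        (fun ν => 2 ^ (top + aexp) * (k₀ + 2 ^ s * ν)) := by
  have hS : 0 < 2 ^ s := pow_pos (by norm_num) _
  have ha : 0 < 2 ^ (top + aexp) := pow_pos (by norm_num) _
  ext c
  simp only [mem_filter, mem_range, mem_image]
  constructor
  · rintro ⟨hc, ξ', hΦ, hacc⟩
    -- `c` is a multiple of `a`
    have hdvd : 2 ^ (top + aexp) ∣ c := by
      by_contra hnd
      obtain ⟨νt, hdec, -⟩ := hacc
      rw [decodeUnit_eq_none_of_not_dvd T ℓe s aexp top K₀ B c hnd] at hdec
      simp at hdec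
    obtain ⟨k, rfl⟩ := hdvd
    have hk : k < 2 ^ s * 2 ^ (ℓe * T) := lt_of_mul_lt_mul_left hc (Nat.zero_le _)
    have hkd : k = k % 2 ^ s + 2 ^ s * (k / 2 ^ s) := (Nat.mod_add_div k (2 ^ s)).symm
    have hν : k / 2 ^ s < 2 ^ (ℓe * T) := Nat.div_lt_of_lt_mul hk
    have hk₀' : k % 2 ^ s < 2 ^ s := Nat.mod_lt _ hS
    rw [hkd] at hacc
    obtain ⟨hval', hball⟩ := (mem_Acc_slice_iff T ℓe s aexp top K₀ B μ δ ξ' hk₀' hν hK kk).1 hacc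
    have heq : k % 2 ^ s = k₀ := signedResidue_unique hk₀ hk₀' hK hval hval'
    exact ⟨k / 2 ^ s, ⟨hν, ξ', hΦ, by rw [← heq]; exact hball⟩, by rw [← heq, ← hkd]⟩
  · rintro ⟨ν, ⟨hν, ξ', hΦ, hball⟩, rfl⟩
    refine ⟨?_, ξ', hΦ, (mem_Acc_slice_iff T ℓe s aexp top K₀ B μ δ ξ' hk₀ hν hK kk).2 ⟨hval, hball⟩⟩
    apply Nat.mul_lt_mul_of_pos_left _ ha
    calc k₀ + 2 ^ s * ν < 2 ^ s + 2 ^ s * ν := by omega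
      _ = 2 ^ s * (ν + 1) := by ring
      _ ≤ 2 ^ s * 2 ^ (ℓe * T) := Nat.mul_le_mul_left _ hν

/-- **A residue that is nobody's signed residue has no accurate characters.** [cite: Hallgren2005, §4] -/
theorem filter_range_Acc_eq_empty (Φ : (Fin T → ℚ) → Prop) (hK : 2 * K₀ < 2 ^ s) (kk : ℤ)
    (hno : ¬ ∃ k₀ < 2 ^ s, (k₀ ≤ K₀ ∧ kk = k₀) ∨ (2 ^ s - K₀ ≤ k₀ ∧ kk = (k₀ : ℤ) - (2 ^ s : ℕ))) :
    (range (2 ^ (top + aexp) * (2 ^ s * 2 ^ (ℓe * T)))).filter (fun c => ∃ ξ' : Fin T → ℚ, Φ ξ' ∧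
        c ∈ Acc ⟨T, ℓe, s, aexp, top, K₀, B⟩
          (fun t => μ t + 1 / (((2 ^ s : ℕ) : ℝ) * ((2 ^ ℓe : ℕ) : ℝ) ^ (T - (t : ℕ)))) δ kk ξ') = ∅ := by
  have hS : 0 < 2 ^ s := pow_pos (by norm_num) _
  refine filter_eq_empty_iff.2 fun c hc => ?_
  rintro ⟨ξ', -, hacc⟩
  have hdvd : 2 ^ (top + aexp) ∣ c := by
    by_contra hnd
    obtain ⟨νt, hdec, -⟩ := hacc
    rw [decodeUnit_eq_none_of_not_dvd T ℓe s aexp top K₀ B c hnd] at hdec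
    simp at hdec
  obtain ⟨k, rfl⟩ := hdvd
  have hk : k < 2 ^ s * 2 ^ (ℓe * T) := lt_of_mul_lt_mul_left (mem_range.1 hc) (Nat.zero_le _)
  have hkd : k = k % 2 ^ s + 2 ^ s * (k / 2 ^ s) := (Nat.mod_add_div k (2 ^ s)).symm
  have hν : k / 2 ^ s < 2 ^ (ℓe * T) := Nat.div_lt_of_lt_mul hk
  have hk₀' : k % 2 ^ s < 2 ^ s := Nat.mod_lt _ hS
  rw [hkd] at hacc
  obtain ⟨hval', -⟩ := (mem_Acc_slice_iff T ℓe s aexp top K₀ B μ δ ξ' hk₀' hν hK kk).1 hacc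
  exact hno ⟨k % 2 ^ s, hk₀', hval'⟩

/-- **An inaccurate character of a slice**: `a(k₀ + Sν) ∉ AccAll` forces the residue into the tail `K₀ < k₀ < S − K₀`,
or else the frequency `ν` to be accurate for no dual vector in the slice of `k₀` (signed residue
`kk = k₀` if `k₀ ≤ K₀`, `kk = k₀ − S` otherwise). [cite: Hallgren2005, §4] -/
theorem not_mem_AccAll_slice_imp (Λ : AddSubgroup (Fin T → ℤ)) {k₀ ν : ℕ} (hk₀ : k₀ < 2 ^ s) (hν : ν < 2 ^ (ℓe * T))
    (hK : 2 * K₀ < 2 ^ s)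
    (h : 2 ^ (top + aexp) * (k₀ + 2 ^ s * ν) ∉ AccAll ⟨T, ℓe, s, aexp, top, K₀, B⟩ Λ
      (fun t => μ t + 1 / (((2 ^ s : ℕ) : ℝ) * ((2 ^ ℓe : ℕ) : ℝ) ^ (T - (t : ℕ)))) δ) :
    (K₀ < k₀ ∧ K₀ < 2 ^ s - k₀) ∨ (¬ (K₀ < k₀ ∧ K₀ < 2 ^ s - k₀) ∧
      ¬ ∃ ζ : Fin T → ℚ, ((∀ t, 0 ≤ ζ t ∧ ζ t < 1) ∧ ∀ v ∈ Λ, ∃ z : ℤ, ∑ t, ζ t * (v t : ℚ) = z) ∧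
        ∀ t : Fin T, |(k₀ : ℝ) / (((2 ^ s : ℕ) : ℝ) * ((2 ^ ℓe : ℕ) : ℝ) ^ (T - (t : ℕ))) +
            ((if k₀ ≤ K₀ then (k₀ : ℤ) else (k₀ : ℤ) - (2 ^ s : ℕ) : ℤ) : ℝ) * μ t + (ζ t : ℝ) +
            (ν : ℝ) / ((2 ^ ℓe : ℕ) : ℝ) ^ (T - (t : ℕ)) -
          round ((k₀ : ℝ) / (((2 ^ s : ℕ) : ℝ) * ((2 ^ ℓe : ℕ) : ℝ) ^ (T - (t : ℕ))) +
            ((if k₀ ≤ K₀ then (k₀ : ℤ) else (k₀ : ℤ) - (2 ^ s : ℕ) : ℤ) : ℝ) * μ t + (ζ t : ℝ) +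
            (ν : ℝ) / ((2 ^ ℓe : ℕ) : ℝ) ^ (T - (t : ℕ)))| ≤ δ) := by
  by_cases htail : K₀ < k₀ ∧ K₀ < 2 ^ s - k₀
  · exact Or.inl htail
  refine Or.inr ⟨htail, ?_⟩
  rintro ⟨ζ, hdual, hball⟩
  apply h
  have hval : (k₀ ≤ K₀ ∧ (if k₀ ≤ K₀ then (k₀ : ℤ) else (k₀ : ℤ) - (2 ^ s : ℕ)) = k₀) ∨
      (2 ^ s - K₀ ≤ k₀ ∧ (if k₀ ≤ K₀ then (k₀ : ℤ) else (k₀ : ℤ) - (2 ^ s : ℕ)) = (k₀ : ℤ) - (2 ^ s : ℕ)) := by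
    by_cases h1 : k₀ ≤ K₀
    · exact Or.inl ⟨h1, by rw [if_pos h1]⟩
    · exact Or.inr ⟨by omega, by rw [if_neg h1]⟩
  exact ⟨_, ζ, hdual, (mem_Acc_slice_iff T ℓe s aexp top K₀ B μ δ ζ hk₀ hν hK _).2 ⟨hval, hball⟩⟩

end Slices

end CubicClassSampling

end Literature.Computability.Cryptography
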